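import Literature.NumberTheory.Automorphic.U3PrincipalSeriesJacquetFiltration        -- ★ N1 (named fact, typ-T3a p826240)
import Literature.NumberTheory.Automorphic.U3PrincipalSeriesLengthLeTwo             -- ★ N3 (named fact, p826287)
import Literature.NumberTheory.Automorphic.U3PrincipalSeriesConstituentEmbeds       -- ★ N2 (named fact, typ-T3a)
import Literature.NumberTheory.Automorphic.CMXiTorusCharSplitTorusDecay             -- ★ p826744 (typ-T3b): R1 ∕ S4 ∕ S5 junction lemmas
import Literature.NumberTheory.Automorphic.CMLocalRingModulusContinuous             -- ★ p826943 (typ-T3b): `continuous_cmXiTorusChar_fst`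
import Literature.NumberTheory.Automorphic.JacquetExponentUnique                    -- ★ p827046 (A-p01): G5
import Literature.NumberTheory.Automorphic.ConstituentsOfExtension                  -- ★ p827291 (this seat): length-two constituents
import Literature.NumberTheory.Automorphic.JacquetLineExponents                     -- ★ p827400 (this seat): Casselman §7.1 line bookkeeping
import Literature.NumberTheory.Automorphic.JacquetLengthTwoLabelsAbs                -- (this seat, p831828): the one-call package `labelledPair_exists_of_line_abs`
import Summits.HodgeConjecture.HodgeConjecture.Theorems.F0P3UnipotentLimitCompactOpen       -- (this seat, p827635): `hN` for exactness
import Summits.HodgeConjecture.HodgeConjecture.Theorems.F0P3XiUnramNonsplitInstance         -- ★ `isAdmissible_cmPrincipalSeries`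
import HarnessLib

/-!
# T3 «KeysCaseTwo» pay-down, stub S2 `stub_labelledPair_of_reducible` (= T3a-TREE glue G4 «exponents of the pair»):
# if `i_G(χ_ξ)` is reducible, its constituents are EXACTLY two classes `πs ≠ πn` with normalised Jacquet characters `χ_ξ` and `wχ_ξ`

Cell hodgecm-mathlib F0∕P3, crux `stmt-HodgeConjecture-24833` (`H413`); line draft of record `F0/P3/Lines-draft/T3b_KeysCaseTwoPaydown.lean` ED. v4
(9d7443d81f71874f), stub S2 — proved here UNDER THE PRINTED LETTERS AS HYPOTHESES (the BY-NAME variant agreed by typ-T3a ∕ typ-T3b, F0/P3/STATUS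
15:00:51Z): N1 ★ `UnitaryGroup.U3PrincipalSeriesJacquetFiltration` [Casselman1995, L. 7.1.1 (a)], N2 ★ `UnitaryGroup.U3PrincipalSeriesConstituentEmbeds`
[Casselman1995, Cor. 6.3.9 (b)], N3 ★ `UnitaryGroup.U3PrincipalSeriesLengthLeTwo` [Casselman1995, Cor. 7.1.2] — all three PAYABLE-NOW in-house per
`F0/P3/T3a-TREE.md` §1.  The binders and the conclusion are those of S2 VERBATIM, with the Lines-level abbreviation `HasJacquetChar L v c θ` INLINED
(`∃ r, IrrClass.mk r = c ∧ Nonempty ((r.ρ.normalizedJacquet (cmBorelTriple L 3 v)).Equiv ((trivial ℂ T ℂ).twist θ))`).  NO square-integrability input: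
the matrix-coefficient letters N5 [Casselman1995, Thm 4.4.6] ∕ N5′ [Prop. 7.1.3] stay confined to stub S3.
HONEST LABEL: HC_CM is proved only modulo the printed citations until rung 0 closes; this file closes S2 MODULO the three letters above and discharges
nothing else.

THE PROOF ([Casselman1995, §7.1]; [Rogawski1990, §12.2 (2) pp. 173–174] «exactly two constituents»).  `I = i_G(χ_ξ)`, `N` the given `G`-stable
`⊥ ≠ N ≠ ⊤`.  Everything generic is ★ and is invoked ONCE (★ `IrrClass.labelledPair_exists_of_line_abs`, `Automorphic/JacquetLengthTwoLabelsAbs`):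
N3 ⇒ `I|_N`, `I⁄N` irreducible and the constituents of `I` are exactly their classes (★ `ConstituentsOfExtension`); `0 → r(N) → r(I) → r(I⁄N) → 0` exact
(★ `jacquet_exact_holds`, its `hN` = ★ `isLimitOfCompactOpen_cmUnipotentU`); `r(N) ≠ 0` by Frobenius on `N ↪ I` and `r(I⁄N) ≠ 0` by Frobenius on the
embedding of `⟦I⁄N⟧` into `i(χ_ξ)` or `i(wχ_ξ)` given by N2 (★ `frobenius_normalizedInd_holds`, `hδ` = ★ `deltaChar_cmBorel_eq_one`); with N1's line
(`dim r(I) = 2`, stable line `wχ_ξ`, quotient `χ_ξ`) ★ `normalizedJacquet_sub_quot_cases_of_line` gives `dim r(N) = dim r(I⁄N) = 1` and the two cases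
(`r(N) = ℓ`: `N` carries `wχ_ξ`, `I⁄N` carries `χ_ξ`; `r(N) ∩ ℓ = 0`: the other way round); `πs ≠ πn` because `χ_ξ ≠ wχ_ξ` (R1: `‖χ_ξ(t)‖ < 1 < ‖wχ_ξ(t)‖`
at ★ p826744's `t`; ★ G5 `HasJacquetExponent.eq_of_forall_eq_smul` transports an equality of classes to an equality of Jacquet characters).

ELABORATION NOTE (why the proof is three `have`s, three `cases` and one `exact`): the statements of N1∕N2∕N3 are `def … : Prop`s whose compiled bodies
abstract proofs into `…._proof_k` constants; their instantiations and this file's statement are therefore definitionally but not syntactically equal deep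
inside the CM carrier, and every meeting of two such copies costs a structural comparison (≈ 10 s … 120 s each at this carrier).  The proof is arranged so
that N1's conclusion is the master copy of the single generic call and nothing is restated (`obtain`∕`rcases`∕`rw … at`∕type ascriptions on these terms do not
terminate in 30 min; `cases … with | intro` and projections are free).

* §1 R1 (`cmWeylTorusCharPair_ne_cmXiTorusChar`); the decay of `χ_ξ,1` (N5′'s proviso at `χ_ξ`) is ★ `UnitaryGroup.norm_cmXiChar_fst_lt_one` (`CMXiTorusCharUnitFacts`);
* §2 the junction `labelledPair_of_reducible`.
References: [Casselman1995, §3.2, §6.3–6.4, §7.1]; [Rogawski1990, §12.2]; [BernsteinZelevinsky1977, §1.9, §2]; [Keys1984, §7].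
-/

set_option autoImplicit false
set_option linter.dupNamespace false

noncomputable section

open NumberField IsDedekindDomain MeasureTheory
open scoped MatrixGroups NNReal

namespace Summit.HodgeConjecture.HodgeConjecture.Cruxes.H413.F0P3KeysLabelledPair

open Literature.NumberTheory.Automorphic Literature.NumberTheory.Automorphic.UnitaryGroup Literature.NumberTheory.Rogawski1990
open Literature.RepresentationTheory.FiniteGroups Literature.RepresentationTheory.Semisimple
open Summit.HodgeConjecture.HodgeConjecture.Cruxes.H413

variable (L : Type) [Field L] [NumberField L] [IsCMField L] (v : HeightOneSpectrum (𝓞 ↥(maximalRealSubfield L)))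

/-! ## §1 R1 (`χ_ξ ≠ wχ_ξ`) -/

/-- **R1: `wχ_ξ ≠ χ_ξ`** — at ★ p826744's `t = d(a, 1, a⁻¹)` (`a = Nm v`), `‖χ_ξ(t)‖ < 1 < ‖wχ_ξ(t)‖`. [cite: Casselman1995, §6.4 «regular»]
[cite: Rogawski1990, §12.2 p. 173] -/
theorem cmWeylTorusCharPair_ne_cmXiTorusChar (μ : (LocalRing L v)ˣ →* ℂˣ)
    (η₁ η₂ : ↥(normOneUnits (conjLocal L (IsCMField.complexConj L) v)) →* ℂˣ)
    (hμ : IsQuadraticCharExtension (conjLocal L (IsCMField.complexConj L) v) μ) :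
    cmWeylTorusCharPair L v
        (η₁.comp (quotConj (conjLocal L (IsCMField.complexConj L) v) (conjLocal_conjLocal_cm L v)) * μ *
          halfModulusChar (LocalRing L v)) η₂ ≠ cmXiTorusChar L v μ η₁ η₂ := by
  intro h
  obtain ⟨t, hfix, h1, hm, hlt⟩ := exists_torusU_one_lt_norm_conj_inv L v μ η₁ η₂ hμ
  have hlt' := norm_cmXiTorusChar_lt_one L v μ η₁ η₂ hμ t hfix h1 hm
  rw [← h] at hlt'
  exact lt_irrefl _ (hlt.trans hlt')

/-! ## §2 Stub S2 (over ★ `Gqs L v`, `χ_ξ = cmXiTorusChar`, `HasJacquetChar` inlined), MODULO the letters N1, N2, N3 -/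

set_option synthInstance.maxHeartbeats 400000 in
set_option maxHeartbeats 100000000 in  -- definitional bookkeeping between the cited statements' elaborations of the CM carrier (see module docstring)
/-- **STUB S2 of the T3 «KeysCaseTwo» pay-down, MODULO THE LETTERS N1 (L. 7.1.1 (a)), N2 (Cor. 6.3.9 (b)), N3 (Cor. 7.1.2) as hypotheses: if `i_G(χ_ξ)` is
reducible, its constituents are EXACTLY two classes `πs ≠ πn`, `πs` with normalised Jacquet module ≅ the character `χ_ξ`, `πn` with `wχ_ξ = (χ̄_ξ,1⁻¹, η₂)`.**
Binders and conclusion = S2 of `F0/P3/Lines-draft/T3b_KeysCaseTwoPaydown.lean` ED. v4 verbatim (`HasJacquetChar` inlined).  For the given `G`-stable `N`,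
`{πs, πn} = {⟦I|_N⟧, ⟦I⁄N⟧}` (which is which is decided by ★ `normalizedJacquet_sub_quot_cases_of_line`); ★ `IrrClass.labelledPair_exists_of_line_abs`
at `I = i_G(χ_ξ)` fed with N1's line data, N2's embedding property, N3's «no 3-chains», ★ `isLimitOfCompactOpen_cmUnipotentU`, ★ `deltaChar_cmBorel_eq_one`,
★ `isAdmissible_cmPrincipalSeries`, and R1 (§1).  No square-integrability input (N5∕N5′ stay with stub S3).
[cite: Casselman1995, L. 7.1.1 (a), Cor. 7.1.2, Cor. 6.3.9 (b), Prop. 6.4.1, Thm 3.2.4] [cite: Rogawski1990, §12.2 (2) pp. 173–174] [cite: Keys1984, §7 Thm (2)] -/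
theorem labelledPair_of_reducible
    (hN1 : U3PrincipalSeriesJacquetFiltration L) (hN2 : U3PrincipalSeriesConstituentEmbeds L) (hN3 : U3PrincipalSeriesLengthLeTwo L)
    (hns : ∀ w : PlacesOver L v, IsCMField.complexConj L • w.1 = w.1)
    (μ : (LocalRing L v)ˣ →* ℂˣ) (η₁ η₂ : ↥(normOneUnits (conjLocal L (IsCMField.complexConj L) v)) →* ℂˣ)
    (hμ : IsQuadraticCharExtension (conjLocal L (IsCMField.complexConj L) v) μ)
    (hμc : Continuous fun x => ((μ x : ℂˣ) : ℂ)) (h1c : Continuous fun x => ((η₁ x : ℂˣ) : ℂ)) (h2c : Continuous fun x => ((η₂ x : ℂˣ) : ℂ))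
    (hred : ∃ N : Subrepresentation (cmPrincipalSeries L 3 v (cmXiTorusChar L v μ η₁ η₂)), N ≠ ⊥ ∧ N ≠ ⊤) :
    ∃ πs πn : IrrClass (Gqs L v), πs ≠ πn ∧
      (∀ c : IrrClass (Gqs L v), c.IsConstituentOf (cmPrincipalSeries L 3 v (cmXiTorusChar L v μ η₁ η₂)) ↔ (c = πn ∨ c = πs)) ∧
      (haveI := locallyCompactSpace_cmBorelU L 3 v
       ∃ r : SmoothIrrep (Gqs L v), IrrClass.mk r = πs ∧
        Nonempty ((r.ρ.normalizedJacquet (cmBorelTriple L 3 v)).Equiv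
          ((Representation.trivial ℂ ↥(torusU (conjLocal L (IsCMField.complexConj L) v) (cmLocalForm L 3 v)) ℂ).twist
            (cmXiTorusChar L v μ η₁ η₂)))) ∧
      (haveI := locallyCompactSpace_cmBorelU L 3 v
       ∃ r : SmoothIrrep (Gqs L v), IrrClass.mk r = πn ∧
        Nonempty ((r.ρ.normalizedJacquet (cmBorelTriple L 3 v)).Equiv
          ((Representation.trivial ℂ ↥(torusU (conjLocal L (IsCMField.complexConj L) v) (cmLocalForm L 3 v)) ℂ).twist
            (cmWeylTorusCharPair L v
              (η₁.comp (quotConj (conjLocal L (IsCMField.complexConj L) v) (conjLocal_conjLocal_cm L v)) * μ *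
                halfModulusChar (LocalRing L v)) η₂)))) := by
  haveI := locallyCompactSpace_cmBorelU L 3 v
  cases hred with
  | intro N hN' =>
  -- the letters at `χ_ξ = (χ_ξ,1, η₂)` (`cmXiTorusChar = cmTorusCharPair χ_ξ,1 η₂` definitionally); N1's conclusion split by `cases`
  have hc1 := continuous_cmXiTorusChar_fst L v μ η₁ hμc h1c
  have hlen := hN3 v hns _ η₂ hc1 h2c
  have hemb := hN2 v hns _ η₂ hc1 h2c
  have h1 := hN1 v hns _ η₂ hc1 h2c
  have hIsm := (F0P3XiUnramNonsplitInstance.isAdmissible_cmPrincipalSeries L v (cmXiTorusChar L v μ η₁ η₂)).isSmooth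
  cases h1 with
  | intro hfd hrest =>
  cases hrest with
  | intro h2 hrest' =>
  cases hrest' with
  | intro ℓ hℓ' =>
  -- ONE generic call (master copy = N1's line data; `Equiv.refl` bridges `cmPrincipalSeries … = i_B^G χ` definitionally), then ONE `exact`
  have H := IrrClass.labelledPair_exists_of_line_abs hfd h2 ℓ hℓ'.1 hℓ'.2.1 hℓ'.2.2
    (F0P3UnipotentLimitCompactOpen.isLimitOfCompactOpen_cmUnipotentU L v)
    (F0P2nBorelCharactersUnipotent.deltaChar_cmBorel_eq_one L v) (Representation.Equiv.refl _) hIsm N hN'.1 hN'.2 hlen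
    (cmWeylTorusCharPair_ne_cmXiTorusChar L v μ η₁ η₂ hμ) hemb (Representation.Equiv.refl _)
  exact H

end Summit.HodgeConjecture.HodgeConjecture.Cruxes.H413.F0P3KeysLabelledPair

end
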